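import Mathlib
import Literature.Computability.Complexity.CliqueTestGraphs
import Summits.PneNP.PneNP.Theorems.ConvexRankGatesConvexGateBlindColorings

/-!
# PneNP / ConvexRankGates — `ConvexGateBlind`: a cone factorisation gives back a CONV gate

Helpers (`--supports stmt-PneNP-10680`). The converse of
`ConvexRankGatesConvexGateBlindFactorisation.lean` (Yannakakis' direction "factorisation ⇒ extended
formulation", with Hrubeš's monotone closure): suppose every `k`-clique-free graph `u` of `K_m` carries a
non-negative edge weighting `w_u` and a threshold `θ_u` with `w_u · u < θ_u`, and the certificate slack
matrix against the `k`-cliques `Q` factorises through the cone `PSD_q × ℝ^r_{≥0}`,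
`w_u · 1_Q - θ_u = tr(H_u Y_Q) + λ_u · s_Q` (`Y_Q ⪰ 0`, `λ_u, s_Q ≥ 0`, and `tr(H_u Z) ≥ 0` for PSD `Z`).
Then ONE CONV gate of the route computes `CLIQUE(m, k)`: variables `(Y, x', s)` packed in one PSD matrix
indexed by `Fin q ⊕ (E ⊕ Fin r)` (`x'`, `s` on the diagonal), rows `x'_e ≤ [x_e]` (the only rows reading
the input, coefficient `+1`) and the EQUATIONS `w_u · x' - tr(H_u Y) - λ_u · s = θ_u` — of which only a
linearly independent subfamily, at most `#E + q² + r + 1` many, is kept (`exists_linearIndependent`;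
an equation in the span of the kept ones follows from them). Completeness: `x' = 1_Q`. Soundness: a
feasible point under a clique-free `u` gives `θ_u ≤ w_u · x' ≤ w_u · u < θ_u`. So, with the factorisation
file, "one CONV gate of polynomial size computes CLIQUE" is EQUIVALENT to "some valid certificate system
has a polynomial cone factorisation" — the matrix form of the crux that lower-bound lines attack.
[folklore: Yannakakis 1991; Gouveia–Parrilo–Thomas 2013, Thm. 1; Hrubeš 2020, §3.4 (monotone closure)]
-/

namespace Summit.PneNP.PneNP.Theorems

open Matrix Finset Literature.Computability.Complexity

/-! ### Block bookkeeping for the packed PSD variable -/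

section blocks

variable {q : ℕ} {κ : Type*} [Fintype κ] [DecidableEq κ]

/-- A block-diagonal matrix with a PSD block and a non-negative diagonal block is PSD. [folklore] -/
theorem posSemidef_fromBlocks_diagonal {Y : Matrix (Fin q) (Fin q) ℝ} (hY : Y.PosSemidef)
    {d : κ → ℝ} (hd : ∀ a, 0 ≤ d a) :
    (Matrix.fromBlocks Y 0 0 (Matrix.diagonal d)).PosSemidef := by
  refine Matrix.PosSemidef.of_dotProduct_mulVec_nonneg ?_ fun v => ?_
  · have h1 : Y.IsHermitian := hY.isHermitian
    have h2 : (Matrix.diagonal d).IsHermitian := by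
      rw [Matrix.IsHermitian, Matrix.conjTranspose_eq_transpose_of_trivial, Matrix.diagonal_transpose]
    exact Matrix.IsHermitian.fromBlocks h1 (by simp) h2
  · rw [Matrix.fromBlocks_mulVec]
    simp only [Matrix.zero_mulVec, add_zero, zero_add]
    have hv : star v = Sum.elim (star (v ∘ Sum.inl)) (star (v ∘ Sum.inr)) := by
      ext (a | a) <;> simp
    rw [hv, sumElim_dotProduct_sumElim]
    refine add_nonneg (hY.dotProduct_mulVec_nonneg _) ?_
    simp only [dotProduct, Matrix.mulVec_diagonal, Pi.star_apply, star_trivial, Function.comp_apply]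
    exact Finset.sum_nonneg fun a _ => by nlinarith [hd a, sq_nonneg (v (Sum.inr a))]

omit [DecidableEq κ] in
/-- The trace of a block matrix is the sum of the traces of its diagonal blocks. [folklore] -/
theorem trace_fromBlocks' (A : Matrix (Fin q) (Fin q) ℝ) (B : Matrix (Fin q) κ ℝ) (C : Matrix κ (Fin q) ℝ)
    (D : Matrix κ κ ℝ) : (Matrix.fromBlocks A B C D).trace = A.trace + D.trace := by
  simp only [Matrix.trace, Matrix.diag_apply, Fintype.sum_sum_type, Matrix.fromBlocks_apply₁₁,
    Matrix.fromBlocks_apply₂₂]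

/-- The trace of `fromBlocks C 0 0 (diagonal c) · 𝒴` reads the top-left block and the bottom-right
diagonal of `𝒴`. [folklore] -/
theorem trace_fromBlocks_diagonal_mul (C : Matrix (Fin q) (Fin q) ℝ) (c : κ → ℝ)
    (𝒴 : Matrix (Fin q ⊕ κ) (Fin q ⊕ κ) ℝ) :
    (Matrix.fromBlocks C 0 0 (Matrix.diagonal c) * 𝒴).trace =
      (C * 𝒴.toBlocks₁₁).trace + ∑ a, c a * 𝒴 (Sum.inr a) (Sum.inr a) := by
  conv_lhs => rw [← Matrix.fromBlocks_toBlocks 𝒴]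
  rw [Matrix.fromBlocks_multiply, trace_fromBlocks']
  simp only [Matrix.zero_mul, add_zero, zero_add]
  congr 1
  simp only [Matrix.trace, Matrix.diag_apply, Matrix.diagonal_mul, Matrix.toBlocks₂₂, of_apply]

/-- The `(a, a)` diagonal entry of `𝒴` in the second block, as a trace. [folklore] -/
theorem trace_single_inr_mul (a : κ) (𝒴 : Matrix (Fin q ⊕ κ) (Fin q ⊕ κ) ℝ) :
    (Matrix.single (Sum.inr a : Fin q ⊕ κ) (Sum.inr a) (1 : ℝ) * 𝒴).trace = 𝒴 (Sum.inr a) (Sum.inr a) := by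
  rw [Matrix.trace]
  simp only [Matrix.diag_apply]
  rw [Finset.sum_eq_single (Sum.inr a : Fin q ⊕ κ)]
  · rw [Matrix.single_mul_apply_same, one_mul]
  · intro b _ hb
    rw [Matrix.single_mul_apply_of_ne _ _ _ _ _ hb]
  · intro h
    exact absurd (Finset.mem_univ _) h

end blocks

/-! ### Equations: a spanning subfamily suffices; cliques inside accepted inputs -/

/-- If finitely many linear "equation functionals" are to vanish at a point, it is enough that those
in a subset `b` with the whole family inside `span b` vanish (evaluation at the point is linear in the
functional). [folklore] -/
theorem forall_eq_zero_of_span {V : Type*} [AddCommGroup V] [Module ℝ V] (ev : V →ₗ[ℝ] ℝ)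
    {T b : Set V} (hTb : T ⊆ Submodule.span ℝ b) (hb : ∀ φ ∈ b, ev φ = 0) :
    ∀ φ ∈ T, ev φ = 0 := by
  intro φ hφ
  have hspan := hTb hφ
  refine Submodule.span_induction (p := fun ψ _ => ev ψ = 0) hb ?_ ?_ ?_ hspan
  · exact map_zero ev
  · intro x y _ _ hx hy
    rw [map_add, hx, hy, add_zero]
  · intro a x _ hx
    rw [map_smul, hx, smul_zero]

/-- A graph with `CLIQUE(m, k) = 1` dominates the clique vector of some `k`-set. [folklore] -/
theorem exists_cliqueVec_le_of_cliqueFn {m k : ℕ} {x : (⊤ : SimpleGraph (Fin m)).edgeSet → Bool} (hx : cliqueFn m k x = true) :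
    ∃ Q : Finset (Fin m), Q.card = k ∧ ∀ e, cliqueVec Q e = true → x e = true := by
  classical
  rw [cliqueFn_eq_true_iff] at hx
  simp only [SimpleGraph.CliqueFree, not_forall, not_not] at hx
  obtain ⟨Q, hQ⟩ := hx
  refine ⟨Q, hQ.card_eq, fun e he => ?_⟩
  obtain ⟨a, b, hab⟩ := sym2_exists_eq_mk (e : Sym2 (Fin m))
  have hmem := e.2
  rw [hab, SimpleGraph.mem_edgeSet, SimpleGraph.top_adj] at hmem
  simp only [cliqueVec, decide_eq_true_eq] at he
  have ha : a ∈ Q := he a (by rw [hab]; exact Sym2.mem_mk_left a b)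
  have hb : b ∈ Q := he b (by rw [hab]; exact Sym2.mem_mk_right a b)
  have hadj : (cliqueGraph x).Adj a b := hQ.isClique ha hb hmem
  rw [cliqueGraph_adj] at hadj
  obtain ⟨hne, hxab⟩ := hadj
  have : e = ⟨s(a, b), by simpa using hmem⟩ := Subtype.ext hab
  rw [this]
  exact hxab

/-! ### The converse of the cone factorisation -/

/-- **A cone factorisation of a valid certificate system yields one CONV gate computing CLIQUE.**
Let `k`-clique-free graphs `u` of `K_m` carry weightings `w_u ≥ 0` and thresholds `θ_u` with
`w_u · u < θ_u`, and suppose `w_u · 1_Q - θ_u = tr(H_u Y_Q) + ∑_ℓ λ_{u,ℓ} s_{Q,ℓ}` for all `k`-sets `Q`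
and clique-free `u`, with `Y_Q ⪰ 0` (`q × q`), `λ_u, s_Q ≥ 0` (`r` terms) and `tr(H_u Z) ≥ 0` for every
PSD `Z` (e.g. `H_u ⪰ 0`). Then there are CONV data — rows indexed by a finite type `R` with
`#R ≤ 2 (#E + q² + r + 1) + #E`, one PSD variable indexed by `Fin q ⊕ (E ⊕ Fin r)`, input coefficients
`B ≥ 0` — whose feasibility at `x` is equivalent to `CLIQUE(m, k)(x) = 1` (`cliqueFn`). With
`isConvGate_of_indexed` (CollapseSystem file) this is one CONV gate of the route of size
`#R + q + #E + r`. [folklore: Yannakakis 1991; Gouveia–Parrilo–Thomas 2013, Thm. 1; Hrubeš 2020, §3.4] -/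
theorem exists_convData_of_factorisation {m k q r : ℕ}
    (w : ((⊤ : SimpleGraph (Fin m)).edgeSet → Bool) → (⊤ : SimpleGraph (Fin m)).edgeSet → ℝ) (θ : ((⊤ : SimpleGraph (Fin m)).edgeSet → Bool) → ℝ)
    (H : ((⊤ : SimpleGraph (Fin m)).edgeSet → Bool) → Matrix (Fin q) (Fin q) ℝ) (lam : ((⊤ : SimpleGraph (Fin m)).edgeSet → Bool) → Fin r → ℝ)
    (Y : Finset (Fin m) → Matrix (Fin q) (Fin q) ℝ) (s : Finset (Fin m) → Fin r → ℝ)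
    (hw : ∀ u, cliqueFn m k u = false → ∀ e, 0 ≤ w u e)
    (hrej : ∀ u, cliqueFn m k u = false → ∑ e, w u e * (if u e then (1 : ℝ) else 0) < θ u)
    (hH : ∀ u, cliqueFn m k u = false → ∀ Z : Matrix (Fin q) (Fin q) ℝ, Z.PosSemidef → 0 ≤ (H u * Z).trace)
    (hlam : ∀ u, cliqueFn m k u = false → ∀ ℓ, 0 ≤ lam u ℓ)
    (hY : ∀ Q : Finset (Fin m), Q.card = k → (Y Q).PosSemidef)
    (hs : ∀ Q : Finset (Fin m), Q.card = k → ∀ ℓ, 0 ≤ s Q ℓ)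
    (hfact : ∀ (Q : Finset (Fin m)) (u : (⊤ : SimpleGraph (Fin m)).edgeSet → Bool), Q.card = k → cliqueFn m k u = false →
      ∑ e, w u e * (if cliqueVec Q e then (1 : ℝ) else 0) - θ u =
        (H u * Y Q).trace + ∑ ℓ, lam u ℓ * s Q ℓ) :
    ∃ (R : Type) (_ : Fintype R),
      Fintype.card R ≤ 2 * (Fintype.card (⊤ : SimpleGraph (Fin m)).edgeSet + q * q + r + 1) + Fintype.card (⊤ : SimpleGraph (Fin m)).edgeSet ∧
      ∃ (A : R → Matrix (Fin q ⊕ ((⊤ : SimpleGraph (Fin m)).edgeSet ⊕ Fin r)) (Fin q ⊕ ((⊤ : SimpleGraph (Fin m)).edgeSet ⊕ Fin r)) ℝ) (b : R → ℝ) (B : R → (⊤ : SimpleGraph (Fin m)).edgeSet → ℝ), (∀ i e, 0 ≤ B i e) ∧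
        ∀ x : (⊤ : SimpleGraph (Fin m)).edgeSet → Bool, cliqueFn m k x = true ↔
          ∃ 𝒴 : Matrix (Fin q ⊕ ((⊤ : SimpleGraph (Fin m)).edgeSet ⊕ Fin r)) (Fin q ⊕ ((⊤ : SimpleGraph (Fin m)).edgeSet ⊕ Fin r)) ℝ, 𝒴.PosSemidef ∧
            ∀ i, (A i * 𝒴).trace ≤ b i + ∑ e, B i e * (if x e then (1 : ℝ) else 0) := by
  classical
  -- the equation functionals: (x'-part, Y-part, s-part, constant)
  let φ : ((⊤ : SimpleGraph (Fin m)).edgeSet → Bool) → (((⊤ : SimpleGraph (Fin m)).edgeSet → ℝ) × (Matrix (Fin q) (Fin q) ℝ × ((Fin r → ℝ) × ℝ))) := fun u => (w u, (-(H u), (-(lam u), -(θ u))))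
  -- evaluation of a functional at variables `(x', Yv, sv)`
  let ev : ((⊤ : SimpleGraph (Fin m)).edgeSet → ℝ) → Matrix (Fin q) (Fin q) ℝ → (Fin r → ℝ) → (((⊤ : SimpleGraph (Fin m)).edgeSet → ℝ) × (Matrix (Fin q) (Fin q) ℝ × ((Fin r → ℝ) × ℝ))) →ₗ[ℝ] ℝ := fun x' Yv sv =>
    { toFun := fun c => c.1 ⬝ᵥ x' + (c.2.1 * Yv).trace + c.2.2.1 ⬝ᵥ sv + c.2.2.2
      map_add' := fun c c' => by
        rw [Prod.fst_add, Prod.snd_add, Prod.fst_add, Prod.snd_add, Prod.fst_add, Prod.snd_add,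
          add_dotProduct, Matrix.add_mul, Matrix.trace_add, add_dotProduct]
        ring
      map_smul' := fun a c => by
        rw [Prod.smul_fst, Prod.smul_snd, Prod.smul_fst, Prod.smul_snd, Prod.smul_fst, Prod.smul_snd,
          smul_dotProduct, Matrix.smul_mul, Matrix.trace_smul, smul_dotProduct, smul_eq_mul, smul_eq_mul,
          smul_eq_mul, smul_eq_mul, RingHom.id_apply]
        ring }
  have hev : ∀ x' Yv sv u, ev x' Yv sv (φ u) =
      ∑ e, w u e * x' e - (H u * Yv).trace - ∑ ℓ, lam u ℓ * sv ℓ - θ u := by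
    intro x' Yv sv u
    simp only [ev, φ, LinearMap.coe_mk, AddHom.coe_mk, dotProduct, Matrix.trace_neg, Pi.neg_apply,
      neg_mul, Finset.sum_neg_distrib]
    ring
  -- a linearly independent spanning subfamily of the equations of clique-free graphs
  let T : Set (((⊤ : SimpleGraph (Fin m)).edgeSet → ℝ) × (Matrix (Fin q) (Fin q) ℝ × ((Fin r → ℝ) × ℝ))) := Set.range fun u : {u : (⊤ : SimpleGraph (Fin m)).edgeSet → Bool // cliqueFn m k u = false} => φ u.1
  obtain ⟨bset, hbT, hspan, hli⟩ := exists_linearIndependent ℝ T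
  have hbfin : bset.Finite := (Set.finite_range _).subset hbT
  obtain ⟨bf, rfl⟩ := hbfin.exists_finset_coe
  have hbcard : bf.card ≤ Fintype.card (⊤ : SimpleGraph (Fin m)).edgeSet + q * q + r + 1 := by
    have h := LinearIndependent.finset_card_le_finrank (b := bf) hli
    have hdim : Module.finrank ℝ (((⊤ : SimpleGraph (Fin m)).edgeSet → ℝ) × (Matrix (Fin q) (Fin q) ℝ × ((Fin r → ℝ) × ℝ))) = Fintype.card (⊤ : SimpleGraph (Fin m)).edgeSet + q * q + r + 1 := by
      rw [Module.finrank_prod, Module.finrank_prod, Module.finrank_prod, Module.finrank_fintype_fun_eq_card,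
        Module.finrank_matrix, Module.finrank_fintype_fun_eq_card, Module.finrank_self, Fintype.card_fin,
        Fintype.card_fin]
      ring
    omega
  have hTspan : T ⊆ (Submodule.span ℝ ((bf : Finset (((⊤ : SimpleGraph (Fin m)).edgeSet → ℝ) × (Matrix (Fin q) (Fin q) ℝ × ((Fin r → ℝ) × ℝ)))) : Set (((⊤ : SimpleGraph (Fin m)).edgeSet → ℝ) × (Matrix (Fin q) (Fin q) ℝ × ((Fin r → ℝ) × ℝ)))) : Set (((⊤ : SimpleGraph (Fin m)).edgeSet → ℝ) × (Matrix (Fin q) (Fin q) ℝ × ((Fin r → ℝ) × ℝ)))) := by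
    rw [hspan]; exact Submodule.subset_span
  -- rows: `β ∈ bf` twice (≤ and ≥), and one row per edge
  refine ⟨(bf ⊕ bf) ⊕ (⊤ : SimpleGraph (Fin m)).edgeSet, inferInstance, ?_, ?_⟩
  · simp only [Fintype.card_sum, Fintype.card_coe]
    omega
  let Arow : (((⊤ : SimpleGraph (Fin m)).edgeSet → ℝ) × (Matrix (Fin q) (Fin q) ℝ × ((Fin r → ℝ) × ℝ))) → Matrix (Fin q ⊕ ((⊤ : SimpleGraph (Fin m)).edgeSet ⊕ Fin r)) (Fin q ⊕ ((⊤ : SimpleGraph (Fin m)).edgeSet ⊕ Fin r)) ℝ := fun c => Matrix.fromBlocks c.2.1 0 0 (Matrix.diagonal (Sum.elim c.1 c.2.2.1))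
  let A : (bf ⊕ bf) ⊕ (⊤ : SimpleGraph (Fin m)).edgeSet → Matrix (Fin q ⊕ ((⊤ : SimpleGraph (Fin m)).edgeSet ⊕ Fin r)) (Fin q ⊕ ((⊤ : SimpleGraph (Fin m)).edgeSet ⊕ Fin r)) ℝ :=
    Sum.elim (Sum.elim (fun β => Arow β.1) (fun β => -Arow β.1))
      (fun e => Matrix.single (Sum.inr (Sum.inl e)) (Sum.inr (Sum.inl e)) 1)
  let bvec : (bf ⊕ bf) ⊕ (⊤ : SimpleGraph (Fin m)).edgeSet → ℝ :=
    Sum.elim (Sum.elim (fun β => -β.1.2.2.2) (fun β => β.1.2.2.2)) (fun _ => 0)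
  let B : (bf ⊕ bf) ⊕ (⊤ : SimpleGraph (Fin m)).edgeSet → (⊤ : SimpleGraph (Fin m)).edgeSet → ℝ :=
    Sum.elim (fun _ _ => 0) (fun e e' => if e' = e then 1 else 0)
  refine ⟨A, bvec, B, ?_, fun x => ?_⟩
  · rintro (β | e) e'
    · simp [B]
    · simp only [B, Sum.elim_inr]
      split_ifs <;> norm_num
  -- reading the rows
  have hArow : ∀ (c : (((⊤ : SimpleGraph (Fin m)).edgeSet → ℝ) × (Matrix (Fin q) (Fin q) ℝ × ((Fin r → ℝ) × ℝ)))) (𝒴 : Matrix (Fin q ⊕ ((⊤ : SimpleGraph (Fin m)).edgeSet ⊕ Fin r)) (Fin q ⊕ ((⊤ : SimpleGraph (Fin m)).edgeSet ⊕ Fin r)) ℝ),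
      (Arow c * 𝒴).trace = (c.2.1 * 𝒴.toBlocks₁₁).trace +
        (∑ e, c.1 e * 𝒴 (Sum.inr (Sum.inl e)) (Sum.inr (Sum.inl e)) +
          ∑ ℓ, c.2.2.1 ℓ * 𝒴 (Sum.inr (Sum.inr ℓ)) (Sum.inr (Sum.inr ℓ))) := by
    intro c 𝒴
    rw [trace_fromBlocks_diagonal_mul, Fintype.sum_sum_type]
    simp only [Sum.elim_inl, Sum.elim_inr]
  have hBrow : ∀ (e : (⊤ : SimpleGraph (Fin m)).edgeSet) (x : (⊤ : SimpleGraph (Fin m)).edgeSet → Bool),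
      ∑ e', B (Sum.inr e) e' * (if x e' then (1 : ℝ) else 0) = if x e then 1 else 0 := by
    intro e x
    simp only [B, Sum.elim_inr, ite_mul, one_mul, zero_mul]
    rw [Finset.sum_ite_eq']
    simp
  have hBrow0 : ∀ (β : bf ⊕ bf) (x : (⊤ : SimpleGraph (Fin m)).edgeSet → Bool),
      ∑ e', B (Sum.inl β) e' * (if x e' then (1 : ℝ) else 0) = 0 := by
    intro β x
    simp [B]
  have hev' : ∀ (c : (((⊤ : SimpleGraph (Fin m)).edgeSet → ℝ) × (Matrix (Fin q) (Fin q) ℝ × ((Fin r → ℝ) × ℝ)))) (𝒴 : Matrix (Fin q ⊕ ((⊤ : SimpleGraph (Fin m)).edgeSet ⊕ Fin r)) (Fin q ⊕ ((⊤ : SimpleGraph (Fin m)).edgeSet ⊕ Fin r)) ℝ),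
      ev (fun e => 𝒴 (Sum.inr (Sum.inl e)) (Sum.inr (Sum.inl e))) 𝒴.toBlocks₁₁
        (fun ℓ => 𝒴 (Sum.inr (Sum.inr ℓ)) (Sum.inr (Sum.inr ℓ))) c = (Arow c * 𝒴).trace + c.2.2.2 := by
    intro c 𝒴
    rw [hArow]
    simp only [ev, LinearMap.coe_mk, AddHom.coe_mk, dotProduct]
    ring
  -- feasibility of `𝒴` unpacked
  have hrows_iff : ∀ (x : (⊤ : SimpleGraph (Fin m)).edgeSet → Bool) (𝒴 : Matrix (Fin q ⊕ ((⊤ : SimpleGraph (Fin m)).edgeSet ⊕ Fin r)) (Fin q ⊕ ((⊤ : SimpleGraph (Fin m)).edgeSet ⊕ Fin r)) ℝ),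
      (∀ i, (A i * 𝒴).trace ≤ bvec i + ∑ e, B i e * (if x e then (1 : ℝ) else 0)) ↔
        ((∀ β : bf, ev (fun e => 𝒴 (Sum.inr (Sum.inl e)) (Sum.inr (Sum.inl e))) 𝒴.toBlocks₁₁
            (fun ℓ => 𝒴 (Sum.inr (Sum.inr ℓ)) (Sum.inr (Sum.inr ℓ))) β.1 = 0) ∧
          ∀ e, 𝒴 (Sum.inr (Sum.inl e)) (Sum.inr (Sum.inl e)) ≤ (if x e then (1 : ℝ) else 0)) := by
    intro x 𝒴
    constructor
    · intro h
      refine ⟨fun β => ?_, fun e => ?_⟩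
      · have h1 := h (Sum.inl (Sum.inl β))
        have h2 := h (Sum.inl (Sum.inr β))
        rw [hBrow0] at h1 h2
        simp only [A, bvec, Sum.elim_inl, Sum.elim_inr, add_zero, Matrix.neg_mul, Matrix.trace_neg] at h1 h2
        rw [hev']
        linarith
      · have h1 := h (Sum.inr e)
        rw [hBrow] at h1
        simp only [A, bvec, Sum.elim_inr, zero_add] at h1
        rwa [trace_single_inr_mul] at h1
    · rintro ⟨hβ, hx⟩ (⟨β | β⟩ | e)
      · have h1 := hβ β
        rw [hev'] at h1
        rw [hBrow0]
        simp only [A, bvec, Sum.elim_inl, add_zero]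
        linarith
      · have h1 := hβ β
        rw [hev'] at h1
        rw [hBrow0]
        simp only [A, bvec, Sum.elim_inl, Sum.elim_inr, add_zero, Matrix.neg_mul, Matrix.trace_neg]
        linarith
      · rw [hBrow]
        simp only [A, bvec, Sum.elim_inr, zero_add]
        rw [trace_single_inr_mul]
        exact hx e
  constructor
  · -- completeness: a `k`-clique `Q ⊆ x` gives the feasible point `(Y_Q, 1_Q, s_Q)`
    intro hx
    obtain ⟨Q, hQk, hQx⟩ := exists_cliqueVec_le_of_cliqueFn hx
    refine ⟨Matrix.fromBlocks (Y Q) 0 0 (Matrix.diagonal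
      (Sum.elim (fun e => if cliqueVec Q e then (1 : ℝ) else 0) (s Q))),
      posSemidef_fromBlocks_diagonal (hY Q hQk) ?_, ?_⟩
    · rintro (e | ℓ)
      · simp only [Sum.elim_inl]; split_ifs <;> norm_num
      · simpa using hs Q hQk ℓ
    · rw [hrows_iff]
      refine ⟨fun β => ?_, fun e => ?_⟩
      · obtain ⟨⟨u, hu⟩, hβu⟩ : β.1 ∈ T := hbT (Finset.mem_coe.2 β.2)
        rw [← hβu, hev]
        simp only [Matrix.toBlocks_fromBlocks₁₁, Matrix.fromBlocks_apply₂₂, Matrix.diagonal_apply_eq,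
          Sum.elim_inl, Sum.elim_inr]
        have h := hfact Q u hQk hu
        linarith
      · simp only [Matrix.fromBlocks_apply₂₂, Matrix.diagonal_apply_eq, Sum.elim_inl]
        by_cases hQe : cliqueVec Q e = true
        · rw [if_pos hQe, if_pos (hQx e hQe)]
        · rw [if_neg hQe]; split_ifs <;> norm_num
  · -- soundness: a feasible point under a clique-free `x` contradicts the certificate of `x`
    rintro ⟨𝒴, h𝒴, hrows⟩
    by_contra hx
    rw [Bool.not_eq_true] at hx
    rw [hrows_iff] at hrows
    obtain ⟨hβ, hxe⟩ := hrows
    have hall := forall_eq_zero_of_span (ev (fun e => 𝒴 (Sum.inr (Sum.inl e)) (Sum.inr (Sum.inl e)))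
      𝒴.toBlocks₁₁ (fun ℓ => 𝒴 (Sum.inr (Sum.inr ℓ)) (Sum.inr (Sum.inr ℓ)))) hTspan
      (fun c hc => hβ ⟨c, hc⟩)
    have hxeq := hall (φ x) ⟨⟨x, hx⟩, rfl⟩
    rw [hev] at hxeq
    have hHx : 0 ≤ (H x * 𝒴.toBlocks₁₁).trace := hH x hx _ (h𝒴.submatrix Sum.inl)
    have hls : 0 ≤ ∑ ℓ, lam x ℓ * 𝒴 (Sum.inr (Sum.inr ℓ)) (Sum.inr (Sum.inr ℓ)) :=
      Finset.sum_nonneg fun ℓ _ => mul_nonneg (hlam x hx ℓ) h𝒴.diag_nonneg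
    have hwx : ∑ e, w x e * 𝒴 (Sum.inr (Sum.inl e)) (Sum.inr (Sum.inl e)) ≤
        ∑ e, w x e * (if x e then (1 : ℝ) else 0) :=
      Finset.sum_le_sum fun e _ => mul_le_mul_of_nonneg_left (hxe e) (hw x hx e)
    have := hrej x hx
    linarith

end Summit.PneNP.PneNP.Theorems
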